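import Summits.MatrixMultiplication.OmegaCensus.SmallFormats.InvertiblePointNearOmegaLaw
import HarnessLib

/-!
# ω-census family (a): η-SPECIAL TERMS at a near-frame point — the kernel core of desk law §8(b) of `NEAR-STRUCTURE.md`

Cell `pub-omega` (unit `pub-omega-tensor-g26`), topic `Summits/MatrixMultiplication/OmegaCensus` (sub-folder `SmallFormats`).
Framing (verbatim): lottery ticket; floor = certified bounds/negative ranges. HONEST FRAMING: elementary linear algebra over an arbitrary
field continuing `InvertiblePointNearFrame` (p493611) and `InvertiblePointNearOmegaLaw` (p513166); it is the kernel form of the counting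
law §8(b) used by the tensor ω-engine (`kitjob-nearomega2`, tensor g26) to close 'case B' of one ω-class per T-type near instance of the
`𝔽₃ ⟨2,2,6⟩@20` census. No rank bound; nothing on `ω`.

**Setting** (`X₀ = 1`, `O` = terms with `f_i(1) ≠ 0`, frame data `f_s(1) g_s(W_j) = δ_{sj} + ρ_s σ_j` on `O`, `σ_{j₀} ≠ 0`), a nonzero
functional `η` on `k^m` and a column vector `v ∈ k^n` such that `η(W_t v) = 0` for every `t ∉ O` ("`ω̂ := η ∘ (· v)` kills the
`Z`-outputs"). Call a form `f` **η-special** if `f(X) = η(X u)` for some `u ∈ k^m`.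
* (`near_relation_coeff`, `linearIndependent_g_of_not_mem`) the forms `g_s`, `s ∈ S`, are linearly independent for every `S ⊆ O ∖ {j₀}`;
* (`eta_mulVec_mul_eq_sum`) Brent read through `ω̂`: `η(X (Y v)) = Σ_{s∈O} η(W_s v) f_s(X) g_s(Y)`;
* (`coord_mulVec_mem_span_g`) each coordinate functional `Y ↦ (Y v)_i` lies in `span{g_s : s ∈ O, η(W_s v) ≠ 0}`, provided every such
  `s` is η-special;
* (`etaSpecial_of_ne_zero_of_not_mem`) if moreover `η(W_{j₀} v) = 0` (the case of an `η`-killed LINE column of the type), every `s ∈ O`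
  with `η(W_s v) ≠ 0` IS η-special (independence of the `g_s` off `j₀`);
* (`etaSpecial_of_ne_zero_of_omega`) in 'case B' (`η(W_{j₀} v) ≠ 0`) the same holds when the removed class `c_{j₀}` is η-special
  (the ω-law `omega_law_of_forall` of p513166 with `ω = ω̂`);
* (`card_mul_le_card_etaSpecial`) **law §8(b), kernel:** for linearly independent `v_1, …, v_r ∈ k^n` with `η(W_t v_l) = 0` (`t ∉ O`)
  such that every `s ∈ O` with some `η(W_s v_l) ≠ 0` is η-special, `m·r ≤ #{s ∈ O : f_s η-special}` — with `m = 2`, `v_1 = b̂` and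
  `v_{1+q}` the η-killed line columns this is '`|H| ≥ 2 + 2k`'.
-/

namespace Summit.MatrixMultiplication.OmegaCensus.SmallFormats

open Module Matrix Literature.Computability.AlgebraicComplexity

variable {k : Type*} [Field k] {m n : ℕ} {ι : Type*} [Fintype ι]

section EtaSpecial

variable (β : BilinComp (mulBilin k m m n) ι) (O : Finset ι)

/-- **Relation coefficients.** With frame data `f_s(1) g_s(W_j) = δ_{sj} + ρ_s σ_j` on `O`: if `Σ_{s∈O} a_s f_s(1) g_s(W_j) = 0` for all
`j ∈ O`, then `a_j = −(Σ_s a_s ρ_s)·σ_j` for every `j ∈ O` (every relation among the `γ_s` is a multiple of `σ`). -/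
theorem near_relation_coeff [DecidableEq ι] {ρ σ : ι → k}
    (hM : ∀ s ∈ O, ∀ j ∈ O, β.f s 1 * β.g s (β.w j) = (if s = j then 1 else 0) + ρ s * σ j)
    (a : ι → k) (ha : ∀ j ∈ O, ∑ s ∈ O, a s * (β.f s 1 * β.g s (β.w j)) = 0) :
    ∀ j ∈ O, a j + (∑ s ∈ O, a s * ρ s) * σ j = 0 := by
  intro j hj
  have h := ha j hj
  rw [Finset.sum_congr rfl fun s hs => by rw [hM s hs j hj]] at h
  simp only [mul_add, Finset.sum_add_distrib, mul_ite, mul_one, mul_zero, Finset.sum_ite_eq' O j, if_pos hj] at h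
  rw [Finset.sum_mul]
  calc a j + ∑ s ∈ O, a s * ρ s * σ j = a j + ∑ s ∈ O, a s * (ρ s * σ j) :=
        by rw [Finset.sum_congr rfl fun s _ => mul_assoc (a s) (ρ s) (σ j)]
    _ = 0 := h

/-- **Independence off `j₀`.** With frame data on `O`, `f_s(1) ≠ 0` on `O` and `σ_{j₀} ≠ 0` (`j₀ ∈ O`): for every `S ⊆ O` with
`j₀ ∉ S` the forms `g_s`, `s ∈ S`, are linearly independent (a relation supported on `S` is a multiple of `σ`, and `σ_{j₀} ≠ 0`). -/
theorem linearIndependent_g_of_not_mem [DecidableEq ι] (hO' : ∀ i ∈ O, β.f i 1 ≠ 0) {ρ σ : ι → k}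
    (hM : ∀ s ∈ O, ∀ j ∈ O, β.f s 1 * β.g s (β.w j) = (if s = j then 1 else 0) + ρ s * σ j)
    {j₀ : ι} (hj₀ : j₀ ∈ O) (hσ : σ j₀ ≠ 0) (S : Finset ι) (hS : S ⊆ O) (hjS : j₀ ∉ S) :
    LinearIndependent k (fun s : S => β.g (s : ι)) := by
  rw [Fintype.linearIndependent_iff]
  intro c hc s₁
  -- extend the coefficients to `O`, divided by `f_s(1)`
  let a : ι → k := fun i => if h : i ∈ S then c ⟨i, h⟩ * (β.f i 1)⁻¹ else 0
  have haS : ∀ s : S, a s = c s * (β.f s 1)⁻¹ := fun s => by simp only [a, dif_pos s.2]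
  have ha0 : ∀ i, i ∉ S → a i = 0 := fun i hi => by simp only [a, dif_neg hi]
  have hrel : ∀ j ∈ O, ∑ s ∈ O, a s * (β.f s 1 * β.g s (β.w j)) = 0 := by
    intro j hj
    have h := congrArg (fun φ : Module.Dual k (Matrix (Fin m) (Fin n) k) => φ (β.w j)) hc
    simp only [LinearMap.coe_sum, Finset.sum_apply, LinearMap.smul_apply, smul_eq_mul,
      LinearMap.zero_apply] at h
    rw [← Finset.sum_subset hS (fun s _ hs => by rw [ha0 s hs, zero_mul]),
      ← Finset.sum_coe_sort S]
    rw [← h]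
    refine Finset.sum_congr rfl fun s _ => ?_
    rw [haS s, mul_assoc, ← mul_assoc ((β.f s 1)⁻¹), inv_mul_cancel₀ (hO' s (hS s.2)), one_mul]
  have hcoef := near_relation_coeff β O hM a hrel
  have hμ : ∑ s ∈ O, a s * ρ s = 0 := by
    have h := hcoef j₀ hj₀
    rw [ha0 j₀ hjS, zero_add] at h
    rcases mul_eq_zero.mp h with h | h
    · exact h
    · exact absurd h hσ
  have h1 := hcoef s₁ (hS s₁.2)
  rw [hμ, zero_mul, add_zero, haS] at h1
  rcases mul_eq_zero.mp h1 with h | h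
  · exact h
  · exact absurd h (inv_ne_zero (hO' s₁ (hS s₁.2)))

/-- The functional `W ↦ η(W v)` (`ω̂ = η ∘ (· v)` of `NEAR-STRUCTURE.md` §8) as an element of the dual. -/
theorem eta_comp_mulVec_apply (η : Module.Dual k (Fin m → k)) (v : Fin n → k) (W : Matrix (Fin m) (Fin n) k) :
    (η.comp ((Matrix.mulVecBilin k k).flip v)) W = η (W *ᵥ v) := by
  simp [Matrix.mulVecBilin_apply]

/-- **Brent read through `ω̂ = η ∘ (· v)`.** If `η(W_t v) = 0` for every `t ∉ O`, then for all `X, Y`: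
`η(X·(Y v)) = Σ_{s∈O} η(W_s v)·f_s(X) g_s(Y)`. -/
theorem eta_mulVec_mul_eq_sum (η : Module.Dual k (Fin m → k)) (v : Fin n → k)
    (hv : ∀ t, t ∉ O → η (β.w t *ᵥ v) = 0) (X : Matrix (Fin m) (Fin m) k) (Y : Matrix (Fin m) (Fin n) k) :
    η (X *ᵥ (Y *ᵥ v)) = ∑ s ∈ O, η (β.w s *ᵥ v) * (β.f s X * β.g s Y) := by
  have h := β.map_eq_sum X Y
  rw [mulBilin_apply] at h
  have h2 := congrArg (fun W : Matrix (Fin m) (Fin n) k => (η.comp ((Matrix.mulVecBilin k k).flip v)) W) h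
  simp only [map_sum, map_smul, smul_eq_mul, eta_comp_mulVec_apply] at h2
  rw [Matrix.mulVec_mulVec, h2, ← Finset.sum_subset (Finset.subset_univ O)]
  · exact Finset.sum_congr rfl fun s _ => by ring
  · intro t _ ht
    rw [hv t ht, mul_zero]

/-- `η((w₀ ⊗ e_i) w) = w_i` when `η(w₀) = 1`: the matrices `X_i := w₀ e_iᵀ` read off coordinates through `η`. -/
theorem eta_vecMulVec_single_mulVec (η : Module.Dual k (Fin m → k)) {w₀ : Fin m → k} (hw₀ : η w₀ = 1)
    (i : Fin m) (w : Fin m → k) : η (vecMulVec w₀ (Pi.single i 1) *ᵥ w) = w i := by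
  have h : vecMulVec w₀ (Pi.single i (1 : k)) *ᵥ w = w i • w₀ := by
    ext j
    simp [vecMulVec_apply, Matrix.mulVec, dotProduct, Pi.single_apply, mul_comm]
  rw [h, map_smul, hw₀, smul_eq_mul, mul_one]

/-- **Coordinate functionals are combinations of the `g_s`.** With `η(w₀) = 1`, `X_i := w₀ e_iᵀ` and `η(W_t v) = 0` off `O`:
`(Y v)_i = Σ_{s∈O} η(W_s v) f_s(X_i) · g_s(Y)` for every `Y`. -/
theorem coord_mulVec_eq_sum (η : Module.Dual k (Fin m → k)) {w₀ : Fin m → k} (hw₀ : η w₀ = 1) (v : Fin n → k)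
    (hv : ∀ t, t ∉ O → η (β.w t *ᵥ v) = 0) (i : Fin m) (Y : Matrix (Fin m) (Fin n) k) :
    (Y *ᵥ v) i = ∑ s ∈ O, (η (β.w s *ᵥ v) * β.f s (vecMulVec w₀ (Pi.single i 1))) * β.g s Y := by
  rw [← eta_vecMulVec_single_mulVec η hw₀ i (Y *ᵥ v),
    eta_mulVec_mul_eq_sum β O η v hv]
  exact Finset.sum_congr rfl fun s _ => by ring

open Classical in
/-- **(Containment.)** Each coordinate functional `Y ↦ (Y v)_i` lies in `span{g_s : s ∈ O, η(W_s v) ≠ 0}` (`η ≠ 0`). -/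
theorem coord_mulVec_mem_span_g [DecidableEq ι] (η : Module.Dual k (Fin m → k)) (hη : η ≠ 0) (v : Fin n → k)
    (hv : ∀ t, t ∉ O → η (β.w t *ᵥ v) = 0) (i : Fin m) :
    (LinearMap.proj i).comp ((Matrix.mulVecBilin k k).flip v) ∈
      Submodule.span k (β.g '' ↑(O.filter fun s => η (β.w s *ᵥ v) ≠ 0)) := by
  obtain ⟨w₁, hw₁⟩ : ∃ w, η w ≠ 0 := by
    by_contra h
    push Not at h
    exact hη (LinearMap.ext h)
  set w₀ : Fin m → k := (η w₁)⁻¹ • w₁ with hw₀def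
  have hw₀ : η w₀ = 1 := by rw [hw₀def, map_smul, smul_eq_mul, inv_mul_cancel₀ hw₁]
  have heq : (LinearMap.proj i).comp ((Matrix.mulVecBilin k k).flip v) =
      ∑ s ∈ O.filter (fun s => η (β.w s *ᵥ v) ≠ 0),
        (η (β.w s *ᵥ v) * β.f s (vecMulVec w₀ (Pi.single i 1))) • β.g s := by
    apply LinearMap.ext
    intro Y
    simp only [LinearMap.coe_comp, Function.comp_apply, LinearMap.coe_proj, Function.eval,
      LinearMap.coe_sum, Finset.sum_apply, LinearMap.smul_apply, smul_eq_mul]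
    rw [Finset.sum_filter, show ((Matrix.mulVecBilin k k).flip v) Y = Y *ᵥ v by simp [Matrix.mulVecBilin_apply],
      coord_mulVec_eq_sum β O η hw₀ v hv i Y]
    refine Finset.sum_congr rfl fun s _ => ?_
    split_ifs with h
    · rfl
    · rw [not_not.mp h, zero_mul, zero_mul]
  rw [heq]
  refine Submodule.sum_mem _ fun s hs => Submodule.smul_mem _ _ (Submodule.subset_span ?_)
  exact ⟨s, by exact_mod_cast hs, rfl⟩

/-- `η(X u) = Σ_j u_j · η(X e_j)`. -/
theorem eta_mulVec_eq_sum_single (η : Module.Dual k (Fin m → k)) (X : Matrix (Fin m) (Fin m) k) (u : Fin m → k) :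
    η (X *ᵥ u) = ∑ j, u j * η (X *ᵥ Pi.single j 1) := by
  have h : X *ᵥ u = ∑ j, u j • (X *ᵥ Pi.single j (1 : k)) := by
    ext i
    simp only [Matrix.mulVec, dotProduct, Finset.sum_apply, Pi.smul_apply, smul_eq_mul, Pi.single_apply,
      mul_ite, mul_one, mul_zero, Finset.sum_ite_eq', Finset.mem_univ, if_true]
    exact Finset.sum_congr rfl fun j _ => mul_comm _ _
  rw [h, map_sum]
  exact Finset.sum_congr rfl fun j _ => by rw [map_smul, smul_eq_mul]

open Classical in
/-- **η-special terms, line case.** With frame data, `f ≠ 0` on `O`, `σ_{j₀} ≠ 0`, `η ≠ 0` and `η(W_t v) = 0` off `O`: if ALSO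
`η(W_{j₀} v) = 0` (e.g. `v = e_q` for a line column `q` of the type whose direction `η` kills), then every `s ∈ O` with `η(W_s v) ≠ 0`
is η-special: `f_s(X) = η(X u_s)` for a fixed `u_s ∈ k^m` (the `g_s` over those `s` are independent since `j₀` is not among them). -/
theorem etaSpecial_of_apply_removed_eq_zero [DecidableEq ι] (hO' : ∀ i ∈ O, β.f i 1 ≠ 0) {ρ σ : ι → k}
    (hM : ∀ s ∈ O, ∀ j ∈ O, β.f s 1 * β.g s (β.w j) = (if s = j then 1 else 0) + ρ s * σ j)
    {j₀ : ι} (hj₀ : j₀ ∈ O) (hσ : σ j₀ ≠ 0) (η : Module.Dual k (Fin m → k)) (hη : η ≠ 0) (v : Fin n → k)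
    (hv : ∀ t, t ∉ O → η (β.w t *ᵥ v) = 0) (hv₀ : η (β.w j₀ *ᵥ v) = 0) {s : ι} (hs : s ∈ O)
    (hA : η (β.w s *ᵥ v) ≠ 0) : ∃ u : Fin m → k, ∀ X, β.f s X = η (X *ᵥ u) := by
  obtain ⟨w₁, hw₁⟩ : ∃ w, η w ≠ 0 := by
    by_contra h
    push Not at h
    exact hη (LinearMap.ext h)
  set w₀ : Fin m → k := (η w₁)⁻¹ • w₁ with hw₀def
  have hw₀ : η w₀ = 1 := by rw [hw₀def, map_smul, smul_eq_mul, inv_mul_cancel₀ hw₁]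
  -- the support `S` of `A_t := η(W_t v)` inside `O` misses `j₀`
  set S : Finset ι := O.filter fun t => η (β.w t *ᵥ v) ≠ 0 with hSdef
  have hSO : S ⊆ O := by rw [hSdef]; exact Finset.filter_subset _ _
  have hj₀S : j₀ ∉ S := by rw [hSdef, Finset.mem_filter]; exact fun h => h.2 hv₀
  have hsS : s ∈ S := by rw [hSdef, Finset.mem_filter]; exact ⟨hs, hA⟩
  have hind := linearIndependent_g_of_not_mem β O hO' hM hj₀ hσ S hSO hj₀S
  let Xb : Fin m → Matrix (Fin m) (Fin m) k := fun i => vecMulVec w₀ (Pi.single i 1)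
  refine ⟨fun i => β.f s (Xb i), fun X => ?_⟩
  -- the coefficients `e_t := A_t (f_t(X) − Σ_i η(X e_i) f_t(X_i))` give a relation among the `g_t`, `t ∈ S`
  let e : ι → k := fun t => η (β.w t *ᵥ v) * (β.f t X - ∑ i, η (X *ᵥ Pi.single i 1) * β.f t (Xb i))
  have heO : ∀ Y, ∑ t ∈ O, e t * β.g t Y = 0 := by
    intro Y
    have h1 := eta_mulVec_mul_eq_sum β O η v hv X Y
    have h2 : ∀ i, (Y *ᵥ v) i = ∑ t ∈ O, (η (β.w t *ᵥ v) * β.f t (Xb i)) * β.g t Y :=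
      fun i => coord_mulVec_eq_sum β O η hw₀ v hv i Y
    have h3 := eta_mulVec_eq_sum_single η X (Y *ᵥ v)
    simp only [e, mul_sub, sub_mul, Finset.sum_sub_distrib, Finset.mul_sum, Finset.sum_mul]
    rw [sub_eq_zero]
    calc ∑ t ∈ O, η (β.w t *ᵥ v) * β.f t X * β.g t Y
        = η (X *ᵥ (Y *ᵥ v)) := by rw [h1]; exact Finset.sum_congr rfl fun t _ => by ring
      _ = ∑ i, (Y *ᵥ v) i * η (X *ᵥ Pi.single i 1) := h3
      _ = ∑ i, (∑ t ∈ O, (η (β.w t *ᵥ v) * β.f t (Xb i)) * β.g t Y) * η (X *ᵥ Pi.single i 1) :=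
          Finset.sum_congr rfl fun i _ => by rw [h2 i]
      _ = ∑ t ∈ O, ∑ i, η (β.w t *ᵥ v) * (η (X *ᵥ Pi.single i 1) * β.f t (Xb i)) * β.g t Y := by
          rw [Finset.sum_comm]
          refine Finset.sum_congr rfl fun i _ => ?_
          rw [Finset.sum_mul]
          exact Finset.sum_congr rfl fun t _ => by ring
  have heS : ∑ t : S, e t • β.g (t : ι) = 0 := by
    apply LinearMap.ext
    intro Y
    simp only [LinearMap.coe_sum, Finset.sum_apply, LinearMap.smul_apply, smul_eq_mul, LinearMap.zero_apply]
    rw [Finset.sum_coe_sort S (fun t => e t * β.g t Y),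
      Finset.sum_subset hSO (fun t ht htS => ?_), heO Y]
    have hAt : η (β.w t *ᵥ v) = 0 := by
      by_contra hne
      exact htS (by rw [hSdef, Finset.mem_filter]; exact ⟨ht, hne⟩)
    simp only [e, hAt, zero_mul]
  have hes : e s = 0 := (Fintype.linearIndependent_iff.mp hind) (fun t => e t) heS ⟨s, hsS⟩
  have hfs : β.f s X = ∑ i, η (X *ᵥ Pi.single i 1) * β.f s (Xb i) := by
    have h := mul_eq_zero.mp hes
    rcases h with h | h
    · exact absurd h hA
    · exact sub_eq_zero.mp h
  rw [hfs, eta_mulVec_eq_sum_single η X]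
  exact Finset.sum_congr rfl fun i _ => mul_comm _ _

/-- **η-special terms via the ω-law (case B of `NEAR-STRUCTURE.md` §8(b)).** With frame data, `f ≠ 0` on `O`, `σ_{j₀} ≠ 0`,
`η(W_t v) = 0` off `O`, and the removed class η-special (`c_{j₀}(X) = f_{j₀}(X)/f_{j₀}(1) = η(X u₀)`): every `s ∈ O` with `η(W_s v) ≠ 0`
is η-special. Proof: the ω-law (`omega_law_of_forall`, p513166) for `ω̂ = η ∘ (· v)` reads `η(X·W'_s v) = A_s c_s(X) − l_s K c_{j₀}(X)`
(`A_s = η(W_s v)`, `K = η(W_{j₀} v)`), and `X ↦ η(X w)` is η-special for every `w`. -/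
theorem etaSpecial_of_removed_etaSpecial [DecidableEq ι] (hO' : ∀ i ∈ O, β.f i 1 ≠ 0) {ρ σ : ι → k}
    (hM : ∀ s ∈ O, ∀ j ∈ O, β.f s 1 * β.g s (β.w j) = (if s = j then 1 else 0) + ρ s * σ j)
    {j₀ : ι} (hj₀ : j₀ ∈ O) (hσ : σ j₀ ≠ 0) (η : Module.Dual k (Fin m → k)) (v : Fin n → k)
    (hv : ∀ t, t ∉ O → η (β.w t *ᵥ v) = 0) {u₀ : Fin m → k} (hu₀ : ∀ X, β.f j₀ X * (β.f j₀ 1)⁻¹ = η (X *ᵥ u₀))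
    {s : ι} (hs : s ∈ O) (hA : η (β.w s *ᵥ v) ≠ 0) : ∃ u : Fin m → k, ∀ X, β.f s X = η (X *ᵥ u) := by
  by_cases hsj : s = j₀
  · subst hsj
    refine ⟨β.f s 1 • u₀, fun X => ?_⟩
    rw [Matrix.mulVec_smul, map_smul, smul_eq_mul, ← hu₀ X]
    field_simp [hO' s hs]
  -- `s ≠ j₀`: the ω-law for `ω̂ := η ∘ (· v)` and the reduced vector `W'_s = W_s − l W_{j₀}`, `l = σ_s/σ_{j₀}`
  obtain ⟨l, hl⟩ : ∃ l : k, σ s = l * σ j₀ := ⟨σ s * (σ j₀)⁻¹, by rw [mul_assoc, inv_mul_cancel₀ hσ, mul_one]⟩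
  let ω : Module.Dual k (Matrix (Fin m) (Fin n) k) := η.comp ((Matrix.mulVecBilin k k).flip v)
  have hωapp : ∀ W, ω W = η (W *ᵥ v) := fun W => eta_comp_mulVec_apply η v W
  have hω : ∀ t, t ∉ O → ω (β.w t) = 0 := fun t ht => by rw [hωapp]; exact hv t ht
  have hW'v : η ((β.w s - l • β.w j₀) *ᵥ v) = η (β.w s *ᵥ v) - l * η (β.w j₀ *ᵥ v) := by
    rw [Matrix.sub_mulVec, Matrix.smul_mulVec, map_sub, map_smul, smul_eq_mul]
  refine ⟨(β.f s 1 * (η (β.w s *ᵥ v))⁻¹) • (((β.w s - l • β.w j₀) *ᵥ v) + (η (β.w j₀ *ᵥ v) * l) • u₀), fun X => ?_⟩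
  have hlaw := omega_law_of_forall β O hO' hM hj₀ hs hl X ω hω
  rw [hωapp, hωapp, hωapp, ← Matrix.mulVec_mulVec, hW'v, hu₀ X] at hlaw
  -- solve for `f_s X`: `c_s(X) · A = η(X w') + K l η(X u₀)`
  have hc : β.f s X * (β.f s 1)⁻¹ * η (β.w s *ᵥ v) =
      η (X *ᵥ ((β.w s - l • β.w j₀) *ᵥ v)) + η (β.w j₀ *ᵥ v) * l * η (X *ᵥ u₀) := by
    linear_combination -hlaw
  have hfs : β.f s X = β.f s 1 * (η (β.w s *ᵥ v))⁻¹ *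
      (η (X *ᵥ ((β.w s - l • β.w j₀) *ᵥ v)) + η (β.w j₀ *ᵥ v) * l * η (X *ᵥ u₀)) := by
    rw [← hc]; field_simp [hO' s hs, hA]
  rw [hfs, Matrix.mulVec_smul, map_smul, smul_eq_mul, Matrix.mulVec_add, map_add, Matrix.mulVec_smul, map_smul,
    smul_eq_mul]

open Classical in
/-- **Counting (the dimension step of §8(b)).** Let `v_1, …, v_r ∈ k^n` be linearly independent with `η(W_t v_l) = 0` for all `t ∉ O`,
`η ≠ 0`, and let `H ⊆ ι` contain every `s ∈ O` with some `η(W_s v_l) ≠ 0`. Then `m·r ≤ |H|`: the `m·r` coordinate functionals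
`Y ↦ (Y v_l)_i` are linearly independent and all lie in `span{g_s : s ∈ H}` (`coord_mulVec_mem_span_g`). -/
theorem card_mul_le_card_of_coord_support [DecidableEq ι] (η : Module.Dual k (Fin m → k)) (hη : η ≠ 0) {r : ℕ}
    (v : Fin r → (Fin n → k)) (hvli : LinearIndependent k v) (hv : ∀ l, ∀ t, t ∉ O → η (β.w t *ᵥ v l) = 0)
    (H : Finset ι) (hH : ∀ l, ∀ s ∈ O, η (β.w s *ᵥ v l) ≠ 0 → s ∈ H) : m * r ≤ H.card := by
  -- the coordinate functionals
  let μ : Fin r × Fin m → Module.Dual k (Matrix (Fin m) (Fin n) k) :=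
    fun p => (LinearMap.proj p.2).comp ((Matrix.mulVecBilin k k).flip (v p.1))
  have hμapp : ∀ p Y, μ p Y = (Y *ᵥ v p.1) p.2 := fun p Y => by
    simp [μ, Matrix.mulVecBilin_apply]
  -- (1) they are linearly independent
  have hμli : LinearIndependent k μ := by
    rw [Fintype.linearIndependent_iff]
    intro c hc p₀
    -- test against the matrices `Y = e_{i₀} wᵀ` with `w = e_j`
    have hx : ∀ i₀ : Fin m, ∑ l, c (l, i₀) • v l = 0 := by
      intro i₀
      ext j
      have h := congrArg (fun φ : Module.Dual k (Matrix (Fin m) (Fin n) k) =>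
        φ (vecMulVec (Pi.single i₀ (1 : k)) (Pi.single j (1 : k)))) hc
      simp only [LinearMap.coe_sum, Finset.sum_apply, LinearMap.smul_apply, smul_eq_mul, LinearMap.zero_apply,
        hμapp] at h
      have hY : ∀ p : Fin r × Fin m, (vecMulVec (Pi.single i₀ (1 : k)) (Pi.single j (1 : k)) *ᵥ v p.1) p.2 =
          if p.2 = i₀ then v p.1 j else 0 := by
        intro p
        simp only [Matrix.mulVec, dotProduct, vecMulVec_apply, Pi.single_apply]
        split_ifs with h2
        · simp
        · simp
      simp_rw [hY, mul_ite, mul_zero] at h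
      rw [Fintype.sum_prod_type] at h
      simp only [Finset.sum_ite_eq', Finset.mem_univ, if_true] at h
      simpa only [Finset.sum_apply, Pi.smul_apply, smul_eq_mul, Pi.zero_apply] using h
    have h0 := (Fintype.linearIndependent_iff.mp hvli) (fun l => c (l, p₀.2)) (hx p₀.2) p₀.1
    exact h0
  -- (2) they lie in the span of the `g_s`, `s ∈ H`
  have hle : Submodule.span k (Set.range μ) ≤ Submodule.span k (↑(H.image β.g) : Set _) := by
    rw [Submodule.span_le]
    rintro _ ⟨p, rfl⟩
    have hmem := coord_mulVec_mem_span_g β O η hη (v p.1) (hv p.1) p.2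
    refine Submodule.span_mono ?_ hmem
    rintro _ ⟨s, hs, rfl⟩
    rw [Finset.coe_image]
    refine ⟨s, ?_, rfl⟩
    have hs' := Finset.mem_filter.mp (by exact_mod_cast hs)
    exact_mod_cast hH p.1 s hs'.1 hs'.2
  -- (3) dimensions
  have h1 : finrank k (Submodule.span k (Set.range μ)) = r * m := by
    rw [finrank_span_eq_card hμli, Fintype.card_prod, Fintype.card_fin, Fintype.card_fin]
  have h2 : finrank k (Submodule.span k (↑(H.image β.g) : Set (Module.Dual k (Matrix (Fin m) (Fin n) k)))) ≤
      (H.image β.g).card := finrank_span_finset_le_card _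
  have h3 := Submodule.finrank_mono hle
  rw [h1] at h3
  have h4 := Finset.card_image_le (s := H) (f := β.g)
  rw [Nat.mul_comm]
  omega

open Classical in
/-- **Law §8(b) of `NEAR-STRUCTURE.md`, kernel form.** At a near-frame point (`X₀ = 1`, frame data on `O`, `f ≠ 0` on `O`, `σ_{j₀} ≠ 0`)
with the removed class `c_{j₀}` η-special: if `v_1, …, v_r ∈ k^n` are linearly independent and `ω̂_l := η ∘ (· v_l)` kills every
`Z`-output (`η(W_t v_l) = 0`, `t ∉ O`), then at least `m·r` terms of `O` are η-special. In the census (`m = 2`, `v_1 = b̂`, the other `v_l`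
the η-killed line columns of the type) this is '`|H| ≥ 2 + 2k`' — the count by which the tensor ω-engine closes case B of the
`η = η_p` class of a T-type near instance. -/
theorem card_mul_le_card_etaSpecial [DecidableEq ι] (hO' : ∀ i ∈ O, β.f i 1 ≠ 0) {ρ σ : ι → k}
    (hM : ∀ s ∈ O, ∀ j ∈ O, β.f s 1 * β.g s (β.w j) = (if s = j then 1 else 0) + ρ s * σ j)
    {j₀ : ι} (hj₀ : j₀ ∈ O) (hσ : σ j₀ ≠ 0) (η : Module.Dual k (Fin m → k)) (hη : η ≠ 0)
    {u₀ : Fin m → k} (hu₀ : ∀ X, β.f j₀ X * (β.f j₀ 1)⁻¹ = η (X *ᵥ u₀))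
    {r : ℕ} (v : Fin r → (Fin n → k)) (hvli : LinearIndependent k v) (hv : ∀ l, ∀ t, t ∉ O → η (β.w t *ᵥ v l) = 0) :
    m * r ≤ (O.filter fun s => ∃ u : Fin m → k, ∀ X, β.f s X = η (X *ᵥ u)).card :=
  card_mul_le_card_of_coord_support β O η hη v hvli hv _ fun l _ hs hA =>
    Finset.mem_filter.mpr ⟨hs, etaSpecial_of_removed_etaSpecial β O hO' hM hj₀ hσ η (v l) (hv l) hu₀ hs hA⟩

end EtaSpecial

end Summit.MatrixMultiplication.OmegaCensus.SmallFormats
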